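import Summits.HodgeConjecture.HodgeConjecture.Theorems.LinearSystemTorelliTranscendentalOrSupportedStubOfMiddleOfPhantomGysin
import Literature.AlgebraicGeometry.Resolution.ProjectiveResolutionProofs

/-!
# Crux `TranscendentalOrSupported` (stmt-HodgeConjecture-10853), line `Sketch` — TIGHTNESS of the
# reduction: the crux implies its GHC-proper residue (modulo Deligne's Cor. 8.2.8)

Companion of `LinearSystemTorelliTranscendentalOrSupportedStubOfMiddleOfPhantomGysin.lean` (p117181),
which proves `MiddleDivisorSupport → residue → TranscendentalOrSupported`. Here the converse for the
residue (registered stub `stub_phantomGysin_of_transcendentalOrSupported`): GRANTED Deligne's Hodge III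
Cor. 8.2.8 in the tree's form (the named fact `Deligne1974_ker_restrictCompl_eq_iSup_range_complexGysin`:
a class dying off a closed `Z` is a sum of Gysin images from a resolving family of `Z`; hypothesis `hD`,
so this file is a CONDITIONAL result), the crux `TranscendentalOrSupported` implies the residue
`stub_phantomGysin` VERBATIM — for `p ≥ 2` every irreducible rationally spanned sub-Hodge structure
`W ⊆ H²ᵖ(X^{2p})` of rank `≥ 2` without `(2p,0)`-part meets
`G¹ H²ᵖ(X) = ⨆ im (g_* : Hᵃ(Y(ℂ); ℂ) → H²ᵖ(X(ℂ); ℂ))` (smooth projective `Y` of dimension `< 2p`)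
non-trivially. With the CLOSED glue item 2411 (`TranscendentalOrSupported → MiddleDivisorSupport`,
`linearSystemTorelli_supportedOfTranscendentalOrSupported_proof`) this certifies, kernel-checked up to
one classical theorem: crux = item 1081 ∧ residue. (Irreducibility and the `(2p,0)`-condition are not
even needed for this direction.)

PROOF. `N¹ ≤ G¹` under `hD` (`residue_supportedClasses_le_iSupGysin`): a class in `N¹ Hᵏ` dies off one
closed `Z` of codimension `≥ 1` (`exists_isClosed_of_mem_supportedClasses`); `Z = ⋃ⱼ gⱼ(Yⱼ)` for
finitely many `gⱼ : Yⱼ ⟶ X` from smooth projective `Yⱼ` of dimensions `< n`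
(`exists_family_iUnion_range_eq`, Hironaka — the tree's THEOREM `Hironaka1964_projective_holds`); so the
class is a sum of Gysin images (`hD.mem_iSup_range`). Together with the unconditional `G¹ ≤ N¹`
(`isotypic_iSupGysin_le_supportedClasses`, p117181): `G¹ = N¹` — Grothendieck's two descriptions of
coniveau `≥ 1` agree (Topology 8 (1969), p. 300). Then the crux puts the span `W` of the rational
`b j` inside `N¹ = G¹`, and `W ≠ ⊥` since `dim W ≥ 2`, so `W ⊓ G¹ = W ≠ ⊥`.

References: P. Deligne, *Théorie de Hodge III*, Publ. Math. IHÉS 44 (1974), Cor. 8.2.8;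
A. Grothendieck, Topology 8 (1969), p. 300; H. Hironaka, Ann. of Math. 79 (1964).
-/

-- mandated namespace `Summit.HodgeConjecture.HodgeConjecture.Theorems` trips `dupNamespace` (off tree-wide)
set_option linter.dupNamespace false

noncomputable section

namespace Summit.HodgeConjecture.HodgeConjecture.Theorems

open CategoryTheory
open Literature.AlgebraicGeometry.HodgeTheory Literature.AlgebraicGeometry.Motives
open Literature.AlgebraicTopology.SingularHomology

variable {n : ℕ} {X : SchemeOver ℂ}

/-- **`N¹ ≤ G¹`, granted Deligne's Cor. 8.2.8** (`hD`): a class `x ∈ N¹ Hᵏ` dies off ONE closed `Z`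
of codimension `≥ 1` (`exists_isClosed_of_mem_supportedClasses`); `Z = ⋃ⱼ gⱼ(Yⱼ)` for finitely many
`gⱼ : Yⱼ ⟶ X` from smooth projective `Yⱼ` of dimensions `mⱼ < n` (`exists_family_iUnion_range_eq`,
Hironaka — the tree's theorem `Hironaka1964_projective_holds`); so `x ∈ Σⱼ im (gⱼ)_*`
(`Deligne1974_ker_restrictCompl_eq_iSup_range_complexGysin.mem_iSup_range`), inside `G¹`.
[cite: DeligneHodgeIII1974, Cor. 8.2.8] [cite: GrothendieckTopology1969, p. 300] -/
theorem residue_supportedClasses_le_iSupGysin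
    (hD : Deligne1974_ker_restrictCompl_eq_iSup_range_complexGysin) (hX : IsSmoothProjective n X)
    (k : ℕ) :
    supportedClasses X k 1 ≤
      ⨆ (μ : OrientationFamily) (m : ℕ) (_ : m < n) (Y : SchemeOver ℂ) (hY : IsSmoothProjective m Y)
        (g : Y ⟶ X) (a : ℕ) (hab : a + 2 * n = k + 2 * m),
        LinearMap.range (complexGysin μ hY hX g hab) := by
  intro x hx
  obtain ⟨Z, hZ, hZ1, hxZ⟩ := exists_isClosed_of_mem_supportedClasses hx
  obtain ⟨ι, _, m, Y, hY, g, hm, hZeq⟩ :=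
    exists_family_iUnion_range_eq Literature.AlgebraicGeometry.Resolution.Hironaka1964_projective_holds
      hX hZ (fun z hz ↦ by exact_mod_cast hZ1 z hz)
  let μ : OrientationFamily := fun _ _ h ↦ Classical.choice (ComplexPoints.isOrientableOver ℂ h)
  have hx' : complexBetti.restrictCompl X (⋃ j, Set.range (g j).left.base) k x = 0 := by
    rw [hZeq]; exact hxZ
  have hmem := hD.mem_iSup_range μ μ.hasPoincareDuality hX hY g hx'
  revert hmem
  refine fun hmem ↦ (iSup_le fun j ↦ iSup_le fun a ↦ iSup_le fun hab ↦ ?_ :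
    (⨆ (j : ι) (a : ℕ) (hab : a + 2 * n = k + 2 * m j),
      LinearMap.range (complexGysin μ (hY j) hX (g j) hab)) ≤ _) hmem
  exact le_iSup_of_le μ (le_iSup_of_le (m j) (le_iSup_of_le (hm j) (le_iSup_of_le (Y j)
    (le_iSup_of_le (hY j) (le_iSup_of_le (g j) (le_iSup_of_le a (le_iSup_of_le hab le_rfl)))))))

/-- **`G¹ = N¹` granted Deligne's Cor. 8.2.8** — Grothendieck's Gysin and kernel descriptions of
coniveau `≥ 1` agree (`isotypic_iSupGysin_le_supportedClasses` is the unconditional half).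
[cite: GrothendieckTopology1969, p. 300] [cite: DeligneHodgeIII1974, Cor. 8.2.8] -/
theorem residue_iSupGysin_eq_supportedClasses
    (hD : Deligne1974_ker_restrictCompl_eq_iSup_range_complexGysin) (hX : IsSmoothProjective n X)
    (k : ℕ) :
    (⨆ (μ : OrientationFamily) (m : ℕ) (_ : m < n) (Y : SchemeOver ℂ) (hY : IsSmoothProjective m Y)
        (g : Y ⟶ X) (a : ℕ) (hab : a + 2 * n = k + 2 * m),
        LinearMap.range (complexGysin μ hY hX g hab)) = supportedClasses X k 1 :=
  le_antisymm (isotypic_iSupGysin_le_supportedClasses hX k) (residue_supportedClasses_le_iSupGysin hD hX k)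

/-- **REGISTERED STUB `stub_phantomGysin_of_transcendentalOrSupported` — tightness of the line's
reduction**: granted Deligne's Cor. 8.2.8 (`hD`), the crux `TranscendentalOrSupported` implies the
GHC-proper residue `stub_phantomGysin` of the skeleton VERBATIM (for `p ≥ 2`, every irreducible
rationally spanned sub-Hodge structure of rank `≥ 2` without `(2p,0)`-part in `H²ᵖ(X^{2p})` meets `G¹`
non-trivially). Proof: the crux applied to the rational spanning family `b` gives `span b ≤ N¹ = G¹`
(`residue_supportedClasses_le_iSupGysin`), and `span b ≠ ⊥` because its rank is `≥ 2`; the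
irreducibility and `(2p,0)` hypotheses are carried but not used. So the residue is EXACTLY the crux
minus its Hodge-conjecture part (item 1081, glue item 2411), modulo one classical theorem.
[cite: DeligneHodgeIII1974, Cor. 8.2.8] [cite: GrothendieckTopology1969, p. 300] -/
theorem stub_phantomGysin_of_transcendentalOrSupported
    (hD : Deligne1974_ker_restrictCompl_eq_iSup_range_complexGysin)
    (hT : Summit.HodgeConjecture.HodgeConjecture.Theses.LinearSystemTorelli.TranscendentalOrSupported) :
    ∀ ⦃p : ℕ⦄ ⦃X : SchemeOver ℂ⦄, 2 ≤ p → ∀ (hX : IsSmoothProjective (2 * p) X)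
    (A : HodgeModel (2 * p) X) (r : ℕ) (b : Fin r → complexBetti X (2 * p)),
    (∀ j, IsRationalClass (b j)) →
    (Submodule.span ℂ (Set.range b)).map (A.pullback (2 * p)).hom =
      ⨆ (p' : ℕ) (q' : ℕ) (_ : p' + q' = 2 * p),
        (Submodule.span ℂ (Set.range b)).map (A.pullback (2 * p)).hom ⊓ A.hodgePQ (2 * p) p' q' →
    (Submodule.span ℂ (Set.range b)).map (A.pullback (2 * p)).hom ⊓ A.hodgePQ (2 * p) (2 * p) 0 = ⊥ →
    (∀ V : Submodule ℂ (complexBetti X (2 * p)), V ≤ Submodule.span ℂ (Set.range b) →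
      Submodule.span ℂ {x : complexBetti X (2 * p) | x ∈ V ∧ IsRationalClass x} = V →
      V.map (A.pullback (2 * p)).hom =
        ⨆ (p' : ℕ) (q' : ℕ) (_ : p' + q' = 2 * p),
          V.map (A.pullback (2 * p)).hom ⊓ A.hodgePQ (2 * p) p' q' →
      V = ⊥ ∨ V = Submodule.span ℂ (Set.range b)) →
    2 ≤ Module.finrank ℂ (Submodule.span ℂ (Set.range b)) →
    Submodule.span ℂ (Set.range b) ⊓
      (⨆ (μ : OrientationFamily) (m : ℕ) (_ : m < 2 * p) (Y : SchemeOver ℂ)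
        (hY : IsSmoothProjective m Y) (g : Y ⟶ X) (a : ℕ) (hab : a + 2 * (2 * p) = 2 * p + 2 * m),
        LinearMap.range (complexGysin μ hY hX g hab)) ≠ ⊥ := by
  intro p X h2 hX A r b hb hsub hbot _ hrk h
  have hle : Submodule.span ℂ (Set.range b) ≤ supportedClasses X (2 * p) 1 := by
    rw [Submodule.span_le]
    rintro _ ⟨j, rfl⟩
    exact hT (by omega) hX A r b hb hsub hbot j
  have hW : Submodule.span ℂ (Set.range b) ≤
      ⨆ (μ : OrientationFamily) (m : ℕ) (_ : m < 2 * p) (Y : SchemeOver ℂ)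
        (hY : IsSmoothProjective m Y) (g : Y ⟶ X) (a : ℕ) (hab : a + 2 * (2 * p) = 2 * p + 2 * m),
        LinearMap.range (complexGysin μ hY hX g hab) :=
    hle.trans (residue_supportedClasses_le_iSupGysin hD hX (2 * p))
  rw [inf_eq_left.2 hW] at h
  rw [h, finrank_bot] at hrk
  omega

end Summit.HodgeConjecture.HodgeConjecture.Theorems

end
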